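/-
Copyright (c) 2026. All rights reserved.
Released under Apache 2.0 license as described in the file LICENSE.
Authors: HodgeCM publication cell (pub-hodgecm), GR lane, seat GR-1 (`pub-hodgecm-own-real34`), after GR-2's
`Prop311PrintedCML2.cmL2Model`.
-/
import Literature.NumberTheory.GelbartRogawski1991.Prop311PrintedCML2
import HarnessLib

/-!
# The `L²(𝐀_Fⁿ)` model of the printed `ρ_ψ` of [GelbartRogawski1991, §3.1] in a Darboux frame — ARBITRARY quadratic `E/F`

Topic `NumberTheory/GelbartRogawski1991`; namespace `Literature.NumberTheory.GelbartRogawski1991.Prop311`.  One definition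
with body (`l2Model`, the model) and proved theorems; nothing of [GelbartRogawski1991] or [Weil1964] is asserted, no
named fact, no instance attribute beyond the local `secondCountableTopology_adeleRing`.

For a quadratic extension `E/F` of number fields with non-trivial automorphism `σ` and `δ ∈ E`, `σ δ = -δ ≠ 0`,
`δ² = d ∈ F`, printed data `(V, Φ)` ([GelbartRogawski1991, §3.1 p. 454 L37–42]: a skew-Hermitian `E`-space) with a
`Φ`-orthogonal `E`-basis `b`, `Φ(bᵢ, bᵢ) = fᵢ δ`, `φ = Tr_{E/F} Φ` non-degenerate, and any Haar measure `ν` on `𝐀_Fⁿ`: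

* `isUnit_det_lineGram_of_nondegenerate` — the frame Gram matrix `T = diag(-2 d fᵢ)` (`symplecticGram F d f`) is
  invertible (`frame_ne_zero_of_nondegenerate`, `isUnit_det_symplecticGram`);
* **`l2Model`** — the `L²(𝐀_Fⁿ, ν)` Schrödinger representation of the coordinate Heisenberg group (standard character
  `ψ_F = adeleAddChar F`, tree `SchrodingerHaar.rep`) read through the Darboux frame `darbouxFrame b f e`
  (`Prop311PrintedMpLeg`): `ρ(h) = ρ_{L²}(toCoordHeisenberg e_D h)` — a representation of the printed Heisenberg group
  `H_𝐀(W)` of `(V, Φ)` (`AdelicHeisenberg F E V Φ`); `l2Model_apply` (unfolding), `norm_l2Model` (it is unitary: the binder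
  `_hρu` of `Prop311AsPrinted`, PROVED);
* **`cmL2Model_eq_l2Model`** — GR-2's CM model `cmL2Model` (`Prop311PrintedCML2`, `(F, E, σ, δ) = (L⁺, L, conj, imagUnit L)`)
  IS `l2Model` at CM data (definitional).

This is the model for which the along-the-section chain (`legOfFrame`, `Prop311PrintedDarbouxLegAlong`) proves the body of
`Prop311AsPrinted` from the record `(pairLineDatum …).CompatibleSplitting`; written for the general-`(F, E, σ)` programme
(seat GR-1, §D «END modulo the record»).  Nothing in this file is a claim of the manuscripts adjudicated by the Hodge-CM cell.

## References
* [GelbartRogawski1991] S. Gelbart, J. Rogawski, Invent. Math. 105 (1991) 445–472, §3.1 p. 454 L17–42.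
* [Weil1964] A. Weil, Acta Math. 111 (1964) 143–211, Chap. I n° 11.
-/

set_option autoImplicit false

noncomputable section

open NumberField MeasureTheory
open scoped TensorProduct Matrix
open Literature.NumberTheory.Automorphic
open Literature.RepresentationTheory.HeisenbergGroup
open Literature.RepresentationTheory.Unitary
open Literature.NumberTheory.Weil1964

namespace Literature.NumberTheory.GelbartRogawski1991

namespace Prop311

open UnitaryDualPair

attribute [local instance] secondCountableTopology_adeleRing

section Quadratic

variable (F : Type) [Field F] [NumberField F]
variable (E : Type) [Field E] [NumberField E] [Algebra F E] [Algebra.IsQuadraticExtension F E]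
variable (σ : E ≃ₐ[F] E) {δ : E} (hσδ : σ δ = -δ) (hδ : δ ≠ 0) {d : F} (hd : δ * δ = algebraMap F E d)
variable (V : Type) [AddCommGroup V] [Module F V] [Module E V] [IsScalarTower F E V]
variable {n : ℕ} (b : Module.Basis (Fin n) E V) (Φ : V →ₗ[F] V →ₗ[F] E) (f : Fin n → F)
variable (e : Fin n × Fin 1 ≃ Fin n) (he : ∀ k : Fin n, (e.symm k).1 = k)
variable (hΦ₁ : ∀ (a : E) (x y : V), Φ (a • x) y = a * Φ x y)
  (hΦ₂ : ∀ (a : E) (x y : V), Φ x (a • y) = Φ x y * σ a)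
  (hb : ∀ i j, i ≠ j → Φ (b i) (b j) = 0)
  (hf : ∀ i, Φ (b i) (b i) = algebraMap F E (f i) * δ)
  (hφ : (traceForm F E V Φ).Nondegenerate)

omit [NumberField E] [Algebra.IsQuadraticExtension F E] [IsScalarTower F E V] in
include σ hδ hd V b Φ hΦ₁ hΦ₂ hb hf hφ in
/-- the Gram matrix `T = diag(-2 d fᵢ)` of a `Φ`-orthogonal frame is invertible as soon as `φ = Tr Φ` is non-degenerate
(`frame_ne_zero_of_nondegenerate`, `isUnit_det_symplecticGram`). [cite: GelbartRogawski1991, §3.1 p. 454 L17, L37–42] -/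
theorem isUnit_det_lineGram_of_nondegenerate : IsUnit (symplecticGram F d f).det :=
  isUnit_det_symplecticGram F f (d_ne_zero F E hδ hd) (frame_ne_zero_of_nondegenerate F E σ V b Φ f hΦ₁ hΦ₂ hb hf hφ)

variable [MeasurableSpace (AdeleRing (𝓞 F) F)] [BorelSpace (AdeleRing (𝓞 F) F)]
  (ν : Measure (Fin n → AdeleRing (𝓞 F) F)) [ν.IsAddHaarMeasure]
  (hψc : Continuous (adeleAddChar F : AdeleRing (𝓞 F) F → Circle))
  (hβc : ∀ y : Fin n → AdeleRing (𝓞 F) F,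
    Continuous fun u : Fin n → AdeleRing (𝓞 F) F => adelicForm F (Fin n) (1 : Matrix (Fin n) (Fin n) (AdeleRing (𝓞 F) F)) u y)

/-- **THE `L²(𝐀_Fⁿ)` MODEL OF THE PRINTED `ρ_ψ` IN A DARBOUX FRAME, for an arbitrary quadratic `E/F`**: the `L²`
Schrödinger representation of the coordinate Heisenberg group with the standard character `ψ_F`, read through
`darbouxFrame b f e` — `ρ(h) = ρ_{L²}(toCoordHeisenberg e_D h)`. [cite: GelbartRogawski1991, §3.1 p. 454 L17–21; Weil1964, Chap. I n° 11] -/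
def l2Model : Representation ℂ (AdelicHeisenberg F E V Φ) (Lp ℂ 2 ν) :=
  (SchrodingerHaar.rep (adelicForm F (Fin n) (1 : Matrix (Fin n) (Fin n) (AdeleRing (𝓞 F) F)))
      (adeleAddChar F) hψc hβc ν).comp
    (toCoordHeisenberg
      (darbouxFrame F E σ hσδ hδ hd V b f e
        (isUnit_det_lineGram_of_nondegenerate F E σ hδ hd V b Φ f hΦ₁ hΦ₂ hb hf hφ))
      (adelicTraceForm_darbouxFrame F E σ hσδ hδ hd V b Φ f e he
        (isUnit_det_lineGram_of_nondegenerate F E σ hδ hd V b Φ f hΦ₁ hΦ₂ hb hf hφ) hΦ₁ hΦ₂ hb hf))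

/-- unfolding of the model. [cite: GelbartRogawski1991, §3.1 p. 454 L17–21] -/
theorem l2Model_apply (h : AdelicHeisenberg F E V Φ) (g : Lp ℂ 2 ν) :
    l2Model F E σ hσδ hδ hd V b Φ f e he hΦ₁ hΦ₂ hb hf hφ ν hψc hβc h g =
      SchrodingerHaar.rep (adelicForm F (Fin n) (1 : Matrix (Fin n) (Fin n) (AdeleRing (𝓞 F) F)))
        (adeleAddChar F) hψc hβc ν
        (toCoordHeisenberg
          (darbouxFrame F E σ hσδ hδ hd V b f e
            (isUnit_det_lineGram_of_nondegenerate F E σ hδ hd V b Φ f hΦ₁ hΦ₂ hb hf hφ))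
          (adelicTraceForm_darbouxFrame F E σ hσδ hδ hd V b Φ f e he
            (isUnit_det_lineGram_of_nondegenerate F E σ hδ hd V b Φ f hΦ₁ hΦ₂ hb hf hφ) hΦ₁ hΦ₂ hb hf) h) g := rfl

/-- **the model is unitary**: `‖ρ(h) g‖ = ‖g‖` (the binder `_hρu` of `Prop311AsPrinted`, PROVED).
[cite: GelbartRogawski1991, §3.1 p. 454 L19–21] -/
theorem norm_l2Model (h : AdelicHeisenberg F E V Φ) (g : Lp ℂ 2 ν) :
    ‖l2Model F E σ hσδ hδ hd V b Φ f e he hΦ₁ hΦ₂ hb hf hφ ν hψc hβc h g‖ = ‖g‖ :=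
  SchrodingerHaar.norm_rep_apply _ _ hψc hβc ν _ g

end Quadratic

/-! ## The CM model is the general model at CM data -/

section CM

variable (L : Type) [Field L] [NumberField L] [IsCMField L]
variable {n : ℕ} (f : Fin n → ↥(maximalRealSubfield L))
variable (e : Fin n × Fin 1 ≃ Fin n) (he : ∀ k : Fin n, (e.symm k).1 = k)
variable (V : Type) [AddCommGroup V] [Module L V]
variable (b : Module.Basis (Fin n) L V) (Φ : V →ₗ[↥(maximalRealSubfield L)] V →ₗ[↥(maximalRealSubfield L)] L)
variable (hΦ₁ : ∀ (a : L) (x y : V), Φ (a • x) y = a * Φ x y)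
  (hΦ₂ : ∀ (a : L) (x y : V), Φ x (a • y) = Φ x y * IsCMField.complexConj L a)
  (hb : ∀ i j, i ≠ j → Φ (b i) (b j) = 0)
  (hf : ∀ i, Φ (b i) (b i) = algebraMap (↥(maximalRealSubfield L)) L (f i) * imagUnit L)
  (hφ : (traceForm (↥(maximalRealSubfield L)) L V Φ).Nondegenerate)
variable [MeasurableSpace (AdeleRing (𝓞 ↥(maximalRealSubfield L)) ↥(maximalRealSubfield L))]
  [BorelSpace (AdeleRing (𝓞 ↥(maximalRealSubfield L)) ↥(maximalRealSubfield L))]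
  (ν : Measure (Fin n → AdeleRing (𝓞 ↥(maximalRealSubfield L)) ↥(maximalRealSubfield L))) [ν.IsAddHaarMeasure]
  (hψc : Continuous (adeleAddChar ↥(maximalRealSubfield L) :
    AdeleRing (𝓞 ↥(maximalRealSubfield L)) ↥(maximalRealSubfield L) → Circle))
  (hβc : ∀ y : Fin n → AdeleRing (𝓞 ↥(maximalRealSubfield L)) ↥(maximalRealSubfield L),
    Continuous fun u : Fin n → AdeleRing (𝓞 ↥(maximalRealSubfield L)) ↥(maximalRealSubfield L) =>
      adelicForm (↥(maximalRealSubfield L)) (Fin n)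
        (1 : Matrix (Fin n) (Fin n) (AdeleRing (𝓞 ↥(maximalRealSubfield L)) ↥(maximalRealSubfield L))) u y)

/-- **GR-2's CM model `cmL2Model` IS `l2Model` at `(F, E, σ, δ) = (L⁺, L, conj, imagUnit L)`** (definitional: the frame's
invertibility witnesses are proofs of the same proposition). [cite: GelbartRogawski1991, §3.1 p. 454 L17–21] -/
theorem cmL2Model_eq_l2Model :
    cmL2Model L f e he V b Φ hΦ₁ hΦ₂ hb hf hφ ν hψc hβc =
      l2Model (↥(maximalRealSubfield L)) L (IsCMField.complexConj L) (complexConj_imagUnit L) (imagUnit_ne_zero L)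
        (imagUnit_mul_self L) V b Φ f e he hΦ₁ hΦ₂ hb hf hφ ν hψc hβc :=
  rfl

end CM

end Prop311

end Literature.NumberTheory.GelbartRogawski1991

end
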